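import Summits.AtomisticToContinuum.BoseEinsteinCondensation.Theses.BECInsertionCorrector
import Summits.AtomisticToContinuum.BoseEinsteinCondensation.Theses.BECPeriodicReduction
import Summits.AtomisticToContinuum.BoseEinsteinCondensation.Theses.BECWallDressingTransfer
import Literature.MathematicalPhysics.QuantumManyBody.BoseEinsteinCondensation
import Literature.MathematicalPhysics.QuantumManyBody.PeriodicBoseGas
import Literature.MathematicalPhysics.QuantumManyBody.GroundState
import Summits.AtomisticToContinuum.BoseEinsteinCondensation.Theorems.BECInsertionCorrectorBoundaryTransferWeakMultiplicativeTransfer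
import Summits.AtomisticToContinuum.BoseEinsteinCondensation.Theorems.BECInsertionCorrectorBoundaryTransferWeakClosing
import Summits.AtomisticToContinuum.BoseEinsteinCondensation.Theorems.BECInsertionCorrectorBoundaryTransferWeakTorusTypicalityBath
import Summits.AtomisticToContinuum.BoseEinsteinCondensation.Theorems.BECInsertionCorrectorBoundaryTransferWeakBoxTransferBath
import Mathlib.MeasureTheory.Measure.WithDensity
import Mathlib.Analysis.SpecialFunctions.Exp
import Mathlib.Analysis.SpecialFunctions.Pow.Real

/-!
# Line `Sketch` (crux idea `coupled-bath-relocation`) for crux `BoundaryTransferWeak`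
# (stmt-AtomisticToContinuum-0827) — SKELETON v3 (lead c1 prover-line-stmt-AtomisticToContinuum-0827-c1-0, 2026-08-17;
# v1/v2 by lead c0 prover-line-stmt-AtomisticToContinuum-0827-0)

## v3 RESHAPE (lead c1): the exceptional-set tolerance `ε` is DECOUPLED from `A`'s constant `c`

v2's box transfer needed `ε ≤ √c/8` (and `ε ≤ 1/2`), with `c` the unquantified constant of the
`A`-instance; so the research stub R′ had to be stated `∀ ε > 0` (after `ρ`), and lead c0 showed that
for hard cores and `ε` below the in-cube core volume fraction `≈ 4.2 ρa³` this forces a near-exact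
positional matching of bulk cores under the coupling (TV-level local indistinguishability — the
research blow-up recorded in `Lines/Sketch.md`, and the reason for c0's `promote-stub`).  The `√c`
enters at ONE place only: the VOLUME clause `|S| ≤ ε|C|`, used through `(∫_S φ)² ≤ |S| ∫_S φ²` to keep
the exceptional set from eating the `c`-weak flat overlap `∫_C φ ≥ (√c/4) (|C| ∫_C φ²)^{1/2}` of the
torus slice.  v3 replaces it by the L¹ clause `∫_S φ ≤ ε ∫_C φ` (relative to the torus slice's own
in-cube L¹ mass): then `∫_{C∖S} φ ≥ (1-ε) ∫_C φ`, every loss is a power of `(1-ε)`, the flatness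
constant becomes `κ₀ = e^{-2M} (1-ε)³ c/16`, and the box constant is positive for EVERY `ε < 1`.
Consequently R‴ (`CoupledRelocationBound` below) quantifies `∀ η > 0, ∃ ε ∈ (0,1), ∃ M` — the tolerance
is the stub's to choose, all cores of both configurations can simply be put into `S`/`T` at any
density, and no core matching is asked for.  (R‴ is not LITERALLY implied by R′ v2 — the L¹ clause
is asked of every good pair, and `(∫_S φ)² ≤ |S| ∫_S φ² ≤ ε₀² |C| ∫_C φ²` converts volume-smallness
into L¹-smallness only for flat `φ` — but it is the weaker demand in substance: it holds with
`S ⊇ all cores`, which R′ at `ε₀ < 4ρa³` does not; see `Lines/Sketch.md` §v3.)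
Stubs v3: `stub_coupledRelocationBoundL1` (R‴, RESEARCH, lead), `stub_boxTransferL1` (B‴, provable:
the v2 proof with a shorter flatness core), `stub_rigidity` (pooled 9072); T′/M/C landed, unchanged.

Crux (route decl, per potential): `BECInsertionCorrector.BoundaryTransferWeak` (= `rfl`
`BECPeriodicReduction.BoundaryTransferWeak`, the decl recorded on the item) :=
`∀ v admissible, PeriodicBECAt v → ∃ ρ₀ > 0, ∀ ρ ∈ (0, ρ₀), HasGroundStateBEC v ρ`.

The line (idea card `Cruxes/BoundaryTransferWeak/Ideas/coupled-bath-relocation.md`): couple the law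
`Q = Ψ_D²` of the Dirichlet ground state `Ψ_D = groundState v (n+1) L` (box of side `L = L_{n+1}(ρ)`)
with the law `P = |Φ|²|_cell` of a torus near-minimiser `Φ` of the SAME `n+1` particles on the cell
(= the box) so that, with probability `≥ 1 - η`, the two one-body SLICES `ψ = Ψ_D(·, X̂)`,
`φ = |Φ(·, Ŷ)|` have bounded RELATIVE relocation cost on the inner cube `C = (L/4, 3L/4)³` off a small
exceptional set `S` (`ψ(x)φ(y) ≤ e^M ψ(y)φ(x)` on `C ∖ S`) and, one-directionally, from `C` to the rest
of the cell (`ψ(y)φ(x) ≤ e^M ψ(x)φ(y)`, `x ∈ C ∖ S`, `y ∈ (cell ∖ C) ∖ T`, `T` of small `ψ`-mass).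
Torus BEC `A` gives (sub-cube pigeonhole + rigid translation + one-bath disintegration + reverse
Markov) a `P`-typical BATH event on which the torus slice has in-cube mass fraction `q_C(φ) ≥ c/16` and
Bhattacharyya flatness `BC_C(φ)² = (∫_C φ)²/(|C| ∫_C φ²) ≥ c/16`; both transfer MULTIPLICATIVELY to the
box slice under the pairwise bounds; so the inner flat mode of the box is occupied
`≥ κ(c, ε, η, M)·(n+1)` in `Ψ_D`, and the landed ground-state → near-minimiser → rigidity →
`condensateNumber` chain closes `HasGroundStateBEC v ρ`.

## v2 RESHAPE (lead c0, cycle 1): `stub_coupledRelocationBound` v1 was MIS-STATED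

v1 (the card's typing) put the tagged particles' agreement on `C`-membership, `(Z 0 ∈ C ↔ W 0 ∈ C)`,
inside the probability-`(1-η)` good event.  That forces `|Q{z₀ ∈ C} - P{w₀ ∈ C}| ≤ η` for every `η > 0`,
eventually — FALSE at the line's own calibration point `v = 0`: the free Dirichlet ground state is
`∏ (2/L)^{3/2} ∏_α sin(π x_{iα}/L)`, so `Q{z₀ ∈ C} = (1/2 + 1/π)³ = 0.548`, while the constant torus
state (an exact minimiser, `periodicEnergy 0 = 0`) has `P{w₀ ∈ C} = |C|/L³ = 1/8`; no coupling charges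
`{z₀ ∈ C ↔ w₀ ∈ C}` with more than `1 - 0.42`.  (For `a > 0` the Dirichlet one-body density is bulk-flat
and the defect is `O(ξ/L) → 0`, which is why the card did not notice.)  Repair: the box functional is
rewritten as a function of the BATH only — `n_C(Ψ)/N = E_Q[q_C(ψ_X̂) · BC_C(ψ_X̂)²]` with
`q_C(ψ) = ∫_C ψ² / ∫ ψ²` the in-cube mass fraction of the slice — so no tagged-particle matching is
needed; the price is the one-directional outside bound above (true at `v = 0` with `M₀ = (3/2) log 2`,
`S = T = ∅`, ANY coupling), which transfers `q_C` exactly as the two-sided bound transfers `BC_C`.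
The v1 stubs `stub_torusTypicality` (p139087) and `stub_boxTransfer` (p140439) are landed, true, and
superseded by their bath-level versions below; `stub_multiplicativeTransfer` (p139456) and
`stub_closing` (p140758) are used as they stand.

TYPING (lead's decision, see PICKED.md): torus side over `δ`-near-minimisers (`δ` after `N`, `A`'s own
objects), Dirichlet side over the tree's `groundState` (a normalised nonnegative minimiser of the closed
form whenever `E₀ < ⊤`, which holds eventually at low density:
`BECInsertionVariance.eventually_groundStateEnergy_ne_top`, `isGroundState_groundState_of_ne_top`).
The inner cube is `TorusInTheBox`'s `θ = 1/4` cube written literally, so that `measurableSet_innerCube`,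
`volume_innerCube`, `lintegral_innerFlatMode_sq`, `aestronglyMeasurable_innerFlatMode` apply.

Registered stubs v3 (signatures in TREE VOCABULARY ONLY):
* `stub_torusTypicalityBath`      (T′; LANDED p141327) — where `A` enters; bath-level event.
* `stub_coupledRelocationBoundL1` (R‴; RESEARCH, held by the lead) — the only cross-b.c. input; v3.
* `stub_multiplicativeTransfer`   (M; LANDED p139456).
* `stub_boxTransferL1`            (B‴; provable, v3 of the landed B′ p143900) — box-side arithmetic.
* `stub_closing`                  (C; LANDED p140758).
* `stub_rigidity`                 (pooled item stmt-AtomisticToContinuum-9072 verbatim; not worked here).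
The assembly `assembly` is PROVED in this file (no stub).  `BoundaryTransferWeak_proof` concludes the
crux BY NAME.
-/

noncomputable section

namespace Summit.AtomisticToContinuum.BoseEinsteinCondensation.Cruxes.BoundaryTransferWeak.CoupledBaths

open Literature.MathematicalPhysics.QuantumManyBody.BoseGas
open _root_.MeasureTheory _root_.Filter
open scoped ENNReal NNReal
open Summit.AtomisticToContinuum.BoseEinsteinCondensation.Theses

/-! ### Vocabulary (local abbreviations; the registered stubs below are stated UNFOLDED) -/

/-- The inner cube `C = (L/4, 3L/4)³` of the box / cell of side `L` (`TorusInTheBox` form, `θ = 1/4`). -/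
def innerCube (L : ℝ) : Set Space :=
  {x : Space | ∀ t, x t ∈ Set.Ioo (1 / 4 * L) (L - 1 / 4 * L)}

/-- The normalised flat mode of the inner cube (`TorusInTheBox` normalisation with `θ = 1/4`). -/
def innerMode (L : ℝ) : Space → ℂ :=
  (innerCube L).indicator fun _ => ((Real.sqrt (((1 - 2 * (1 / 4)) * L) ^ 3))⁻¹ : ℂ)

/-- The law `Q = Ψ_D² dZ` of the Dirichlet ground state `Ψ_D = groundState v (n+1) L` on `(ℝ³)^{n+1}`. -/
def gsLaw (v : ℝ → ℝ≥0∞) (n : ℕ) (L : ℝ) : Measure (Config (n + 1)) :=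
  volume.withDensity fun Z => ENNReal.ofReal (groundState v (n + 1) L Z) ^ 2

/-- The law `P = |Φ|² 1_{cell^{n+1}} dW` of a periodic trial state on the fundamental cell. -/
def torusLaw {n : ℕ} {L : ℝ} (Φ : PeriodicTrialState (n + 1) L) : Measure (Config (n + 1)) :=
  (volume.restrict (cellN (n + 1) L)).withDensity fun W => (‖Φ.ψ W‖₊ : ℝ≥0∞) ^ 2

/-- The GOOD EVENT (v3, bath level) of a pair (box configuration `Z`, torus configuration `W`) at
tolerance `ε` and cost bound `M`, a statement about the two SLICES `ψ = Ψ_D(·, tail Z) ≥ 0` and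
`φ = |Φ(·, tail W)|` only: `ψ` has positive finite mass on `C` and finite total mass; off an
exceptional measurable `S ⊆ C` carrying `≤ ε` of the torus slice's in-cube L¹ mass (v3: this
replaces v2's relative-volume clause `|S| ≤ ε|C|`) and `≤ ε` of both in-cube slice L² masses, the
relative relocation cost is bounded two-sidedly INSIDE `C`, `ψ(x)φ(y) ≤ e^M ψ(y)φ(x)`
(`x, y ∈ C ∖ S`); and off a measurable `T` of `ψ`-mass `≤ ε ∫ψ²` it is bounded one-sidedly from `C`
OUTWARDS, `ψ(y)φ(x) ≤ e^M ψ(x)φ(y)` (`x ∈ C ∖ S`, `y ∈ (cell ∖ C) ∖ T`): the box slice puts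
relatively no more mass outside the inner cube than the torus slice does. -/
def GoodPair (v : ℝ → ℝ≥0∞) (n : ℕ) (L : ℝ) (Φ : PeriodicTrialState (n + 1) L) (ε M : ℝ)
    (Z W : Config (n + 1)) : Prop :=
  0 < ∫⁻ x in {x : Space | ∀ t, x t ∈ Set.Ioo (1 / 4 * L) (L - 1 / 4 * L)},
      ENNReal.ofReal (groundState v (n + 1) L (Matrix.vecCons x (Matrix.vecTail Z))) ^ 2 ∧
  ∫⁻ x in {x : Space | ∀ t, x t ∈ Set.Ioo (1 / 4 * L) (L - 1 / 4 * L)},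
      ENNReal.ofReal (groundState v (n + 1) L (Matrix.vecCons x (Matrix.vecTail Z))) ^ 2 < ⊤ ∧
  ∫⁻ x, ENNReal.ofReal (groundState v (n + 1) L (Matrix.vecCons x (Matrix.vecTail Z))) ^ 2 < ⊤ ∧
  ∃ S ⊆ {x : Space | ∀ t, x t ∈ Set.Ioo (1 / 4 * L) (L - 1 / 4 * L)},
    MeasurableSet S ∧
    ∫⁻ y in S, ENNReal.ofReal ‖Φ.ψ (Matrix.vecCons y (Matrix.vecTail W))‖ ≤
      ENNReal.ofReal ε * ∫⁻ y in {x : Space | ∀ t, x t ∈ Set.Ioo (1 / 4 * L) (L - 1 / 4 * L)},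
        ENNReal.ofReal ‖Φ.ψ (Matrix.vecCons y (Matrix.vecTail W))‖ ∧
    ∫⁻ x in S, ENNReal.ofReal (groundState v (n + 1) L (Matrix.vecCons x (Matrix.vecTail Z))) ^ 2 ≤
      ENNReal.ofReal ε * ∫⁻ x in {x : Space | ∀ t, x t ∈ Set.Ioo (1 / 4 * L) (L - 1 / 4 * L)},
        ENNReal.ofReal (groundState v (n + 1) L (Matrix.vecCons x (Matrix.vecTail Z))) ^ 2 ∧
    ∫⁻ y in S, ENNReal.ofReal ‖Φ.ψ (Matrix.vecCons y (Matrix.vecTail W))‖ ^ 2 ≤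
      ENNReal.ofReal ε * ∫⁻ y in {x : Space | ∀ t, x t ∈ Set.Ioo (1 / 4 * L) (L - 1 / 4 * L)},
        ENNReal.ofReal ‖Φ.ψ (Matrix.vecCons y (Matrix.vecTail W))‖ ^ 2 ∧
    (∀ x ∈ {x : Space | ∀ t, x t ∈ Set.Ioo (1 / 4 * L) (L - 1 / 4 * L)} \ S,
      ∀ y ∈ {x : Space | ∀ t, x t ∈ Set.Ioo (1 / 4 * L) (L - 1 / 4 * L)} \ S,
        groundState v (n + 1) L (Matrix.vecCons x (Matrix.vecTail Z)) * ‖Φ.ψ (Matrix.vecCons y (Matrix.vecTail W))‖ ≤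
          Real.exp M * (groundState v (n + 1) L (Matrix.vecCons y (Matrix.vecTail Z)) * ‖Φ.ψ (Matrix.vecCons x (Matrix.vecTail W))‖)) ∧
    ∃ T : Set Space, MeasurableSet T ∧
      ∫⁻ y in T, ENNReal.ofReal (groundState v (n + 1) L (Matrix.vecCons y (Matrix.vecTail Z))) ^ 2 ≤
        ENNReal.ofReal ε * ∫⁻ x, ENNReal.ofReal (groundState v (n + 1) L (Matrix.vecCons x (Matrix.vecTail Z))) ^ 2 ∧
      ∀ x ∈ {x : Space | ∀ t, x t ∈ Set.Ioo (1 / 4 * L) (L - 1 / 4 * L)} \ S,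
        ∀ y ∈ (cell L \ {x : Space | ∀ t, x t ∈ Set.Ioo (1 / 4 * L) (L - 1 / 4 * L)}) \ T,
          groundState v (n + 1) L (Matrix.vecCons y (Matrix.vecTail Z)) * ‖Φ.ψ (Matrix.vecCons x (Matrix.vecTail W))‖ ≤
            Real.exp M * (groundState v (n + 1) L (Matrix.vecCons x (Matrix.vecTail Z)) * ‖Φ.ψ (Matrix.vecCons y (Matrix.vecTail W))‖)

/-- The TORUS-TYPICAL BATH EVENT at level `c` (v2): the slice `φ = |Φ(·, tail W)|` has positive mass on
`C`, finite mass on the cell, in-cube mass fraction `q_C(φ) = ∫_C φ² / ∫_cell φ² ≥ c/16` and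
Bhattacharyya flatness `(∫_C φ)² ≥ (c/16) |C| ∫_C φ²`.  (Depends on `W` only through `tail W`.) -/
def TorusGood {n : ℕ} {L : ℝ} (Φ : PeriodicTrialState (n + 1) L) (c : ℝ) (W : Config (n + 1)) :
    Prop :=
  0 < ∫⁻ y in {x : Space | ∀ t, x t ∈ Set.Ioo (1 / 4 * L) (L - 1 / 4 * L)},
      ENNReal.ofReal ‖Φ.ψ (Matrix.vecCons y (Matrix.vecTail W))‖ ^ 2 ∧
  ∫⁻ y in cell L, ENNReal.ofReal ‖Φ.ψ (Matrix.vecCons y (Matrix.vecTail W))‖ ^ 2 < ⊤ ∧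
  ENNReal.ofReal (c / 16) * ∫⁻ y in cell L, ENNReal.ofReal ‖Φ.ψ (Matrix.vecCons y (Matrix.vecTail W))‖ ^ 2 ≤
    ∫⁻ y in {x : Space | ∀ t, x t ∈ Set.Ioo (1 / 4 * L) (L - 1 / 4 * L)},
      ENNReal.ofReal ‖Φ.ψ (Matrix.vecCons y (Matrix.vecTail W))‖ ^ 2 ∧
  ENNReal.ofReal (c / 16) *
      (volume {x : Space | ∀ t, x t ∈ Set.Ioo (1 / 4 * L) (L - 1 / 4 * L)} *
        ∫⁻ y in {x : Space | ∀ t, x t ∈ Set.Ioo (1 / 4 * L) (L - 1 / 4 * L)},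
          ENNReal.ofReal ‖Φ.ψ (Matrix.vecCons y (Matrix.vecTail W))‖ ^ 2) ≤
    (∫⁻ y in {x : Space | ∀ t, x t ∈ Set.Ioo (1 / 4 * L) (L - 1 / 4 * L)},
        ENNReal.ofReal ‖Φ.ψ (Matrix.vecCons y (Matrix.vecTail W))‖) ^ 2

/-- The box constant (v3) `κ(c, ε, η, M) = (c/16 - η) · κ₀ · κ₁ / 2` with
`κ₀ = e^{-2M}(1-ε)³ c/16` (flatness transfer; v2 had `e^{-2M}(1-ε)(√c/4-ε)²`) and
`κ₁ = (1-ε)/(1 + 16e^{2M}/(c(1-ε)))` (in-cube mass-fraction transfer); positive for all `ε < 1`,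
`η < c/16`. -/
def boxConstant (c ε η M : ℝ) : ℝ :=
  (c / 16 - η) * ((Real.exp (-2 * M) * ((1 - ε) ^ 3 * (c / 16))) *
          ((1 - ε) / (1 + 16 * Real.exp (2 * M) / (c * (1 - ε))))) / 2

/-! ### Named statements of the line -/

/-- **T′ — torus typicality, bath level** (provable now): an `A`-instance with constant `c` at slack
`δ` on the torus of side `L` yields a `δ`-near-minimiser `Φ` whose law charges the torus-typical BATH
event at level `c` with probability `≥ c/16`.  (Near-minimiser existence; sub-cube pigeonhole
`n₀ ≤ Σ_j n_{C_j}`; rigid translation `PeriodicTrialState.exists_translate`/`periodicEnergy_translate`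
onto the inner cube; one-bath disintegration `n_C(Φ)/N ≤ E_P[q_C(φ_Ŵ)·BC_C(φ_Ŵ)²]` with
`q_C · BC_C² = (∫_C φ)²/(|C| ∫_cell φ²) ≤ 1`; reverse Markov; on `{F ≥ c/16}` both factors are
`≥ c/16`.)  The v1 form with the tagged particle, `stub_torusTypicality`, is landed (p139087). -/
def TorusTypicality : Prop :=
  ∀ (v : ℝ → ℝ≥0∞) (n : ℕ) (L : ℝ), 0 < L → ∀ c : ℝ, 0 < c → ∀ δ : ℝ≥0∞, 0 < δ →
    (∀ Φ : PeriodicTrialState (n + 1) L,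
      periodicEnergy v Φ ≤ periodicGroundStateEnergy v (n + 1) L + δ →
        ENNReal.ofReal (c * (n + 1 : ℕ)) ≤ condensateOccupation (n + 1) L Φ.ψ) →
    ∃ Φ : PeriodicTrialState (n + 1) L,
      periodicEnergy v Φ ≤ periodicGroundStateEnergy v (n + 1) L + δ ∧
      ∃ E : Set (Config (n + 1)), MeasurableSet E ∧
        ENNReal.ofReal (c / 16) ≤ torusLaw Φ E ∧ ∀ W ∈ E, TorusGood Φ c W

/-- **R‴ — coupled relocation bound** (RESEARCH STUB of the line, v3, typed over the tree's objects):
for every admissible `v`, at small density, for every failure tolerance `η > 0` there are an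
exceptional-set tolerance `ε ∈ (0, 1)` and a cost bound `M` (v3: `ε` is existential — v2 had
`∀ ε > 0 ∀ η > 0 ∃ M`) such that eventually in `N = n+1` (whenever `E₀^D < ⊤`), at some slack `δ > 0`,
for every torus `δ`-near-minimiser `Φ` the laws `Q = (groundState v (n+1) L)²` and `P = |Φ|²|_cell`
admit a coupling charging a measurable good event (`GoodPair … ε M`, bath level, v3 clauses) with
probability `≥ 1 - η`.  No printed source (bounded boundary influence — "weak locality" — of the
ground-state conditional amplitude of one particle given the others, jointly under a coupling of the
two laws); calibration `v = 0`: true with `M₀ = (3/2) log 2 + log 3`, `ε = 1/2`, any coupling, `δ`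
small after `(n, η)`. -/
def CoupledRelocationBound : Prop :=
  ∀ v : ℝ → ℝ≥0∞, IsRepulsiveFiniteRange v → ∃ ρ₁ : ℝ, 0 < ρ₁ ∧ ∀ ρ : ℝ, 0 < ρ → ρ < ρ₁ →
    ∀ η : ℝ, 0 < η → ∃ ε M : ℝ, 0 < ε ∧ ε < 1 ∧ ∀ᶠ n : ℕ in atTop,
      groundStateEnergy v (n + 1) (sideLength ρ (n + 1)) ≠ ⊤ →
      ∃ δ : ℝ≥0∞, 0 < δ ∧ ∀ Φ : PeriodicTrialState (n + 1) (sideLength ρ (n + 1)),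
        periodicEnergy v Φ ≤ periodicGroundStateEnergy v (n + 1) (sideLength ρ (n + 1)) + δ →
        ∃ π : Measure (Config (n + 1) × Config (n + 1)),
          π.map Prod.fst = gsLaw v n (sideLength ρ (n + 1)) ∧ π.map Prod.snd = torusLaw Φ ∧
          ∃ G : Set (Config (n + 1) × Config (n + 1)), MeasurableSet G ∧
            ENNReal.ofReal (1 - η) ≤ π G ∧
            ∀ p ∈ G, GoodPair v n (sideLength ρ (n + 1)) Φ ε M p.1 p.2

/-- **M — multiplicative Bhattacharyya flatness transfer** (card's `MultiplicativeFlatnessTransfer`;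
LANDED p139456). -/
def MultiplicativeFlatnessTransfer : Prop :=
  ∀ (C : Set Space) (f g : Space → ℝ) (M : ℝ), MeasurableSet C → Measurable f → Measurable g →
    (∀ x ∈ C, 0 ≤ f x) → (∀ x ∈ C, 0 ≤ g x) →
    (∀ x ∈ C, ∀ y ∈ C, f x * g y ≤ Real.exp M * (f y * g x)) →
      (∫⁻ x in C, ENNReal.ofReal (g x)) ^ 2 * ∫⁻ x in C, ENNReal.ofReal (f x) ^ 2 ≤
        ENNReal.ofReal (Real.exp (2 * M)) *
          ((∫⁻ x in C, ENNReal.ofReal (f x)) ^ 2 * ∫⁻ x in C, ENNReal.ofReal (g x) ^ 2)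

/-- **B‴ — box transfer, bath level, v3** (provable now): the coupling arithmetic.  From `M`, a
coupling with a good event of probability `≥ 1 - η` (v3 clauses, any `ε < 1`) and a torus-typical
bath event of probability `≥ c/16`, the inner flat mode of the box is occupied `≥ κ(c,ε,η,M)·(n+1)`
in the Dirichlet ground state: `n_C(Ψ_D)/N = E_Q[f]`, `f(Z) = (∫_C ψ)²/(|C| ∫ ψ²) = q_C(ψ)·BC_C(ψ)²`,
and on `G ∩ snd⁻¹E` `BC_C(ψ)² ≥ κ₀ = e^{-2M}(1-ε)³c/16` (two-sided bound + `M` on `C ∖ S`,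
`∫_{C∖S} φ ≥ (1-ε)∫_C φ` by the L¹ clause, `∫_{C∖S} ψ² ≥ (1-ε) ∫_C ψ²`) and `q_C(ψ) ≥ κ₁`
(outside bound, as in v2), so `E_Q[f] ≥ κ₀κ₁ · π(G ∩ snd⁻¹E) ≥ κ₀κ₁(c/16 - η)`. -/
def BoxTransfer : Prop :=
  MultiplicativeFlatnessTransfer →
  ∀ (v : ℝ → ℝ≥0∞) (n : ℕ) (L : ℝ), 0 < L → groundStateEnergy v (n + 1) L ≠ ⊤ →
    ∀ (c ε η M : ℝ), 0 < c → 0 < ε → ε < 1 → 0 < η → η < c / 16 →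
    ∀ Φ : PeriodicTrialState (n + 1) L,
      (∃ π : Measure (Config (n + 1) × Config (n + 1)),
        π.map Prod.fst = gsLaw v n L ∧ π.map Prod.snd = torusLaw Φ ∧
        ∃ G : Set (Config (n + 1) × Config (n + 1)), MeasurableSet G ∧
          ENNReal.ofReal (1 - η) ≤ π G ∧ ∀ p ∈ G, GoodPair v n L Φ ε M p.1 p.2) →
      (∃ E : Set (Config (n + 1)), MeasurableSet E ∧
        ENNReal.ofReal (c / 16) ≤ torusLaw Φ E ∧ ∀ W ∈ E, TorusGood Φ c W) →
      ENNReal.ofReal (boxConstant c ε η M * (n + 1 : ℕ)) ≤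
        occupation (n + 1) (innerMode L) fun Z => (groundState v (n + 1) L Z : ℂ)

/-- **C — closing chain, per potential** (LANDED p140758): inner flat-mode occupation `≥ κ(n+1)` of
the Dirichlet ground state eventually in `n`, plus `L²`-rigidity of Dirichlet near-minimisers
(stmt-9072), give `HasGroundStateBEC v ρ`. -/
def ClosingChain : Prop :=
  ∀ v : ℝ → ℝ≥0∞, IsRepulsiveFiniteRange v → BECWallDressingTransfer.GroundStateRigidity →
    ∃ ρ₂ : ℝ, 0 < ρ₂ ∧ ∀ ρ : ℝ, 0 < ρ → ρ < ρ₂ → ∀ κ : ℝ, 0 < κ →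
      (∀ᶠ n : ℕ in atTop,
        groundStateEnergy v (n + 1) (sideLength ρ (n + 1)) ≠ ⊤ ∧
        ENNReal.ofReal (κ * (n + 1 : ℕ)) ≤
          occupation (n + 1) (innerMode (sideLength ρ (n + 1)))
            fun Z => (groundState v (n + 1) (sideLength ρ (n + 1)) Z : ℂ)) →
      HasGroundStateBEC v ρ

/-! ### Registered stubs (signatures unfolded into tree vocabulary) -/

/-- **Stub T′** (LANDED p141327, `CoupledBaths.stub_torusTypicalityBath`): torus typicality, bath level. -/
theorem stub_torusTypicalityBath :
    ∀ (v : ℝ → ℝ≥0∞) (n : ℕ) (L : ℝ), 0 < L → ∀ c : ℝ, 0 < c → ∀ δ : ℝ≥0∞, 0 < δ →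
    (∀ Φ : PeriodicTrialState (n + 1) L,
      periodicEnergy v Φ ≤ periodicGroundStateEnergy v (n + 1) L + δ →
        ENNReal.ofReal (c * (n + 1 : ℕ)) ≤ condensateOccupation (n + 1) L Φ.ψ) →
    ∃ Φ : PeriodicTrialState (n + 1) L,
      periodicEnergy v Φ ≤ periodicGroundStateEnergy v (n + 1) L + δ ∧
      ∃ E : Set (Config (n + 1)), MeasurableSet E ∧
        ENNReal.ofReal (c / 16) ≤
          ((volume.restrict (cellN (n + 1) L)).withDensity fun W => (‖Φ.ψ W‖₊ : ℝ≥0∞) ^ 2) E ∧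
        ∀ W ∈ E,
          0 < ∫⁻ y in {x : Space | ∀ t, x t ∈ Set.Ioo (1 / 4 * L) (L - 1 / 4 * L)},
              ENNReal.ofReal ‖Φ.ψ (Matrix.vecCons y (Matrix.vecTail W))‖ ^ 2 ∧
          ∫⁻ y in cell L, ENNReal.ofReal ‖Φ.ψ (Matrix.vecCons y (Matrix.vecTail W))‖ ^ 2 < ⊤ ∧
          ENNReal.ofReal (c / 16) * ∫⁻ y in cell L, ENNReal.ofReal ‖Φ.ψ (Matrix.vecCons y (Matrix.vecTail W))‖ ^ 2 ≤
            ∫⁻ y in {x : Space | ∀ t, x t ∈ Set.Ioo (1 / 4 * L) (L - 1 / 4 * L)},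
              ENNReal.ofReal ‖Φ.ψ (Matrix.vecCons y (Matrix.vecTail W))‖ ^ 2 ∧
          ENNReal.ofReal (c / 16) *
              (volume {x : Space | ∀ t, x t ∈ Set.Ioo (1 / 4 * L) (L - 1 / 4 * L)} *
                ∫⁻ y in {x : Space | ∀ t, x t ∈ Set.Ioo (1 / 4 * L) (L - 1 / 4 * L)},
                  ENNReal.ofReal ‖Φ.ψ (Matrix.vecCons y (Matrix.vecTail W))‖ ^ 2) ≤
            (∫⁻ y in {x : Space | ∀ t, x t ∈ Set.Ioo (1 / 4 * L) (L - 1 / 4 * L)},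
                ENNReal.ofReal ‖Φ.ψ (Matrix.vecCons y (Matrix.vecTail W))‖) ^ 2 :=
  _root_.Summit.AtomisticToContinuum.BoseEinsteinCondensation.CoupledBaths.stub_torusTypicalityBath

/-- **Stub R‴** (RESEARCH, held by the lead; v3): the coupled relocation bound, bath level, with the
L¹ exceptional-set clause and an existential tolerance `ε ∈ (0,1)`. -/
theorem stub_coupledRelocationBoundL1 :
    ∀ v : ℝ → ℝ≥0∞, IsRepulsiveFiniteRange v → ∃ ρ₁ : ℝ, 0 < ρ₁ ∧ ∀ ρ : ℝ, 0 < ρ → ρ < ρ₁ →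
    ∀ η : ℝ, 0 < η → ∃ ε M : ℝ, 0 < ε ∧ ε < 1 ∧ ∀ᶠ n : ℕ in atTop,
      groundStateEnergy v (n + 1) (sideLength ρ (n + 1)) ≠ ⊤ →
      ∃ δ : ℝ≥0∞, 0 < δ ∧ ∀ Φ : PeriodicTrialState (n + 1) (sideLength ρ (n + 1)),
        periodicEnergy v Φ ≤ periodicGroundStateEnergy v (n + 1) (sideLength ρ (n + 1)) + δ →
        ∃ π : Measure (Config (n + 1) × Config (n + 1)),
          π.map Prod.fst = volume.withDensity (fun Z => ENNReal.ofReal (groundState v (n + 1) (sideLength ρ (n + 1)) Z) ^ 2) ∧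
          π.map Prod.snd = ((volume.restrict (cellN (n + 1) (sideLength ρ (n + 1)))).withDensity fun W => (‖Φ.ψ W‖₊ : ℝ≥0∞) ^ 2) ∧
          ∃ G : Set (Config (n + 1) × Config (n + 1)), MeasurableSet G ∧
            ENNReal.ofReal (1 - η) ≤ π G ∧
            ∀ p ∈ G,
              0 < ∫⁻ x in {x : Space | ∀ t, x t ∈ Set.Ioo (1 / 4 * sideLength ρ (n + 1)) (sideLength ρ (n + 1) - 1 / 4 * sideLength ρ (n + 1))},
                  ENNReal.ofReal (groundState v (n + 1) (sideLength ρ (n + 1)) (Matrix.vecCons x (Matrix.vecTail p.1))) ^ 2 ∧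
              ∫⁻ x in {x : Space | ∀ t, x t ∈ Set.Ioo (1 / 4 * sideLength ρ (n + 1)) (sideLength ρ (n + 1) - 1 / 4 * sideLength ρ (n + 1))},
                  ENNReal.ofReal (groundState v (n + 1) (sideLength ρ (n + 1)) (Matrix.vecCons x (Matrix.vecTail p.1))) ^ 2 < ⊤ ∧
              ∫⁻ x, ENNReal.ofReal (groundState v (n + 1) (sideLength ρ (n + 1)) (Matrix.vecCons x (Matrix.vecTail p.1))) ^ 2 < ⊤ ∧
              ∃ S ⊆ {x : Space | ∀ t, x t ∈ Set.Ioo (1 / 4 * sideLength ρ (n + 1)) (sideLength ρ (n + 1) - 1 / 4 * sideLength ρ (n + 1))},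
                MeasurableSet S ∧
                ∫⁻ y in S, ENNReal.ofReal ‖Φ.ψ (Matrix.vecCons y (Matrix.vecTail p.2))‖ ≤
                  ENNReal.ofReal ε * ∫⁻ y in {x : Space | ∀ t, x t ∈ Set.Ioo (1 / 4 * sideLength ρ (n + 1)) (sideLength ρ (n + 1) - 1 / 4 * sideLength ρ (n + 1))},
                    ENNReal.ofReal ‖Φ.ψ (Matrix.vecCons y (Matrix.vecTail p.2))‖ ∧
                ∫⁻ x in S, ENNReal.ofReal (groundState v (n + 1) (sideLength ρ (n + 1)) (Matrix.vecCons x (Matrix.vecTail p.1))) ^ 2 ≤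
                  ENNReal.ofReal ε * ∫⁻ x in {x : Space | ∀ t, x t ∈ Set.Ioo (1 / 4 * sideLength ρ (n + 1)) (sideLength ρ (n + 1) - 1 / 4 * sideLength ρ (n + 1))},
                    ENNReal.ofReal (groundState v (n + 1) (sideLength ρ (n + 1)) (Matrix.vecCons x (Matrix.vecTail p.1))) ^ 2 ∧
                ∫⁻ y in S, ENNReal.ofReal ‖Φ.ψ (Matrix.vecCons y (Matrix.vecTail p.2))‖ ^ 2 ≤
                  ENNReal.ofReal ε * ∫⁻ y in {x : Space | ∀ t, x t ∈ Set.Ioo (1 / 4 * sideLength ρ (n + 1)) (sideLength ρ (n + 1) - 1 / 4 * sideLength ρ (n + 1))},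
                    ENNReal.ofReal ‖Φ.ψ (Matrix.vecCons y (Matrix.vecTail p.2))‖ ^ 2 ∧
                (∀ x ∈ {x : Space | ∀ t, x t ∈ Set.Ioo (1 / 4 * sideLength ρ (n + 1)) (sideLength ρ (n + 1) - 1 / 4 * sideLength ρ (n + 1))} \ S,
                  ∀ y ∈ {x : Space | ∀ t, x t ∈ Set.Ioo (1 / 4 * sideLength ρ (n + 1)) (sideLength ρ (n + 1) - 1 / 4 * sideLength ρ (n + 1))} \ S,
                    groundState v (n + 1) (sideLength ρ (n + 1)) (Matrix.vecCons x (Matrix.vecTail p.1)) * ‖Φ.ψ (Matrix.vecCons y (Matrix.vecTail p.2))‖ ≤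
                      Real.exp M * (groundState v (n + 1) (sideLength ρ (n + 1)) (Matrix.vecCons y (Matrix.vecTail p.1)) * ‖Φ.ψ (Matrix.vecCons x (Matrix.vecTail p.2))‖)) ∧
                ∃ T : Set Space, MeasurableSet T ∧
                  ∫⁻ y in T, ENNReal.ofReal (groundState v (n + 1) (sideLength ρ (n + 1)) (Matrix.vecCons y (Matrix.vecTail p.1))) ^ 2 ≤
                    ENNReal.ofReal ε * ∫⁻ x, ENNReal.ofReal (groundState v (n + 1) (sideLength ρ (n + 1)) (Matrix.vecCons x (Matrix.vecTail p.1))) ^ 2 ∧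
                  ∀ x ∈ {x : Space | ∀ t, x t ∈ Set.Ioo (1 / 4 * sideLength ρ (n + 1)) (sideLength ρ (n + 1) - 1 / 4 * sideLength ρ (n + 1))} \ S,
                    ∀ y ∈ (cell (sideLength ρ (n + 1)) \ {x : Space | ∀ t, x t ∈ Set.Ioo (1 / 4 * sideLength ρ (n + 1)) (sideLength ρ (n + 1) - 1 / 4 * sideLength ρ (n + 1))}) \ T,
                      groundState v (n + 1) (sideLength ρ (n + 1)) (Matrix.vecCons y (Matrix.vecTail p.1)) * ‖Φ.ψ (Matrix.vecCons x (Matrix.vecTail p.2))‖ ≤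
                        Real.exp M * (groundState v (n + 1) (sideLength ρ (n + 1)) (Matrix.vecCons x (Matrix.vecTail p.1)) * ‖Φ.ψ (Matrix.vecCons y (Matrix.vecTail p.2))‖) := by
  sorry

/-- **Stub M** (LANDED p139456, `CoupledBaths.stub_multiplicativeTransfer`). -/
theorem stub_multiplicativeTransfer :
    ∀ (C : Set Space) (f g : Space → ℝ) (M : ℝ), MeasurableSet C → Measurable f → Measurable g →
    (∀ x ∈ C, 0 ≤ f x) → (∀ x ∈ C, 0 ≤ g x) →
    (∀ x ∈ C, ∀ y ∈ C, f x * g y ≤ Real.exp M * (f y * g x)) →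
      (∫⁻ x in C, ENNReal.ofReal (g x)) ^ 2 * ∫⁻ x in C, ENNReal.ofReal (f x) ^ 2 ≤
        ENNReal.ofReal (Real.exp (2 * M)) *
          ((∫⁻ x in C, ENNReal.ofReal (f x)) ^ 2 * ∫⁻ x in C, ENNReal.ofReal (g x) ^ 2) :=
  _root_.Summit.AtomisticToContinuum.BoseEinsteinCondensation.CoupledBaths.stub_multiplicativeTransfer

/-- **Stub B‴** (v3 of the landed B′ p143900; to be landed as `CoupledBaths.stub_boxTransferL1`): the
box transfer, bath level, for the v3 good event and any `ε < 1`. -/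
theorem stub_boxTransferL1 :
    (∀ (C : Set Space) (f g : Space → ℝ) (M : ℝ), MeasurableSet C → Measurable f → Measurable g →
      (∀ x ∈ C, 0 ≤ f x) → (∀ x ∈ C, 0 ≤ g x) →
      (∀ x ∈ C, ∀ y ∈ C, f x * g y ≤ Real.exp M * (f y * g x)) →
        (∫⁻ x in C, ENNReal.ofReal (g x)) ^ 2 * ∫⁻ x in C, ENNReal.ofReal (f x) ^ 2 ≤
          ENNReal.ofReal (Real.exp (2 * M)) *
            ((∫⁻ x in C, ENNReal.ofReal (f x)) ^ 2 * ∫⁻ x in C, ENNReal.ofReal (g x) ^ 2)) →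
    ∀ (v : ℝ → ℝ≥0∞) (n : ℕ) (L : ℝ), 0 < L → groundStateEnergy v (n + 1) L ≠ ⊤ →
    ∀ (c ε η M : ℝ), 0 < c → 0 < ε → ε < 1 → 0 < η → η < c / 16 →
    ∀ Φ : PeriodicTrialState (n + 1) L,
      (∃ π : Measure (Config (n + 1) × Config (n + 1)),
        π.map Prod.fst = volume.withDensity (fun Z => ENNReal.ofReal (groundState v (n + 1) L Z) ^ 2) ∧
        π.map Prod.snd = ((volume.restrict (cellN (n + 1) L)).withDensity fun W => (‖Φ.ψ W‖₊ : ℝ≥0∞) ^ 2) ∧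
        ∃ G : Set (Config (n + 1) × Config (n + 1)), MeasurableSet G ∧
          ENNReal.ofReal (1 - η) ≤ π G ∧
          ∀ p ∈ G,
              0 < ∫⁻ x in {x : Space | ∀ t, x t ∈ Set.Ioo (1 / 4 * L) (L - 1 / 4 * L)},
                  ENNReal.ofReal (groundState v (n + 1) L (Matrix.vecCons x (Matrix.vecTail p.1))) ^ 2 ∧
              ∫⁻ x in {x : Space | ∀ t, x t ∈ Set.Ioo (1 / 4 * L) (L - 1 / 4 * L)},
                  ENNReal.ofReal (groundState v (n + 1) L (Matrix.vecCons x (Matrix.vecTail p.1))) ^ 2 < ⊤ ∧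
              ∫⁻ x, ENNReal.ofReal (groundState v (n + 1) L (Matrix.vecCons x (Matrix.vecTail p.1))) ^ 2 < ⊤ ∧
              ∃ S ⊆ {x : Space | ∀ t, x t ∈ Set.Ioo (1 / 4 * L) (L - 1 / 4 * L)},
                MeasurableSet S ∧
                ∫⁻ y in S, ENNReal.ofReal ‖Φ.ψ (Matrix.vecCons y (Matrix.vecTail p.2))‖ ≤
                  ENNReal.ofReal ε * ∫⁻ y in {x : Space | ∀ t, x t ∈ Set.Ioo (1 / 4 * L) (L - 1 / 4 * L)},
                    ENNReal.ofReal ‖Φ.ψ (Matrix.vecCons y (Matrix.vecTail p.2))‖ ∧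
                ∫⁻ x in S, ENNReal.ofReal (groundState v (n + 1) L (Matrix.vecCons x (Matrix.vecTail p.1))) ^ 2 ≤
                  ENNReal.ofReal ε * ∫⁻ x in {x : Space | ∀ t, x t ∈ Set.Ioo (1 / 4 * L) (L - 1 / 4 * L)},
                    ENNReal.ofReal (groundState v (n + 1) L (Matrix.vecCons x (Matrix.vecTail p.1))) ^ 2 ∧
                ∫⁻ y in S, ENNReal.ofReal ‖Φ.ψ (Matrix.vecCons y (Matrix.vecTail p.2))‖ ^ 2 ≤
                  ENNReal.ofReal ε * ∫⁻ y in {x : Space | ∀ t, x t ∈ Set.Ioo (1 / 4 * L) (L - 1 / 4 * L)},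
                    ENNReal.ofReal ‖Φ.ψ (Matrix.vecCons y (Matrix.vecTail p.2))‖ ^ 2 ∧
                (∀ x ∈ {x : Space | ∀ t, x t ∈ Set.Ioo (1 / 4 * L) (L - 1 / 4 * L)} \ S,
                  ∀ y ∈ {x : Space | ∀ t, x t ∈ Set.Ioo (1 / 4 * L) (L - 1 / 4 * L)} \ S,
                    groundState v (n + 1) L (Matrix.vecCons x (Matrix.vecTail p.1)) * ‖Φ.ψ (Matrix.vecCons y (Matrix.vecTail p.2))‖ ≤
                      Real.exp M * (groundState v (n + 1) L (Matrix.vecCons y (Matrix.vecTail p.1)) * ‖Φ.ψ (Matrix.vecCons x (Matrix.vecTail p.2))‖)) ∧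
                ∃ T : Set Space, MeasurableSet T ∧
                  ∫⁻ y in T, ENNReal.ofReal (groundState v (n + 1) L (Matrix.vecCons y (Matrix.vecTail p.1))) ^ 2 ≤
                    ENNReal.ofReal ε * ∫⁻ x, ENNReal.ofReal (groundState v (n + 1) L (Matrix.vecCons x (Matrix.vecTail p.1))) ^ 2 ∧
                  ∀ x ∈ {x : Space | ∀ t, x t ∈ Set.Ioo (1 / 4 * L) (L - 1 / 4 * L)} \ S,
                    ∀ y ∈ (cell L \ {x : Space | ∀ t, x t ∈ Set.Ioo (1 / 4 * L) (L - 1 / 4 * L)}) \ T,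
                      groundState v (n + 1) L (Matrix.vecCons y (Matrix.vecTail p.1)) * ‖Φ.ψ (Matrix.vecCons x (Matrix.vecTail p.2))‖ ≤
                        Real.exp M * (groundState v (n + 1) L (Matrix.vecCons x (Matrix.vecTail p.1)) * ‖Φ.ψ (Matrix.vecCons y (Matrix.vecTail p.2))‖)) →
      (∃ E : Set (Config (n + 1)), MeasurableSet E ∧
        ENNReal.ofReal (c / 16) ≤ ((volume.restrict (cellN (n + 1) L)).withDensity fun W => (‖Φ.ψ W‖₊ : ℝ≥0∞) ^ 2) E ∧
        ∀ W ∈ E,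
            0 < ∫⁻ y in {x : Space | ∀ t, x t ∈ Set.Ioo (1 / 4 * L) (L - 1 / 4 * L)},
                ENNReal.ofReal ‖Φ.ψ (Matrix.vecCons y (Matrix.vecTail W))‖ ^ 2 ∧
            ∫⁻ y in cell L, ENNReal.ofReal ‖Φ.ψ (Matrix.vecCons y (Matrix.vecTail W))‖ ^ 2 < ⊤ ∧
            ENNReal.ofReal (c / 16) * ∫⁻ y in cell L, ENNReal.ofReal ‖Φ.ψ (Matrix.vecCons y (Matrix.vecTail W))‖ ^ 2 ≤
              ∫⁻ y in {x : Space | ∀ t, x t ∈ Set.Ioo (1 / 4 * L) (L - 1 / 4 * L)},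
                ENNReal.ofReal ‖Φ.ψ (Matrix.vecCons y (Matrix.vecTail W))‖ ^ 2 ∧
            ENNReal.ofReal (c / 16) *
                (volume {x : Space | ∀ t, x t ∈ Set.Ioo (1 / 4 * L) (L - 1 / 4 * L)} *
                  ∫⁻ y in {x : Space | ∀ t, x t ∈ Set.Ioo (1 / 4 * L) (L - 1 / 4 * L)},
                    ENNReal.ofReal ‖Φ.ψ (Matrix.vecCons y (Matrix.vecTail W))‖ ^ 2) ≤
              (∫⁻ y in {x : Space | ∀ t, x t ∈ Set.Ioo (1 / 4 * L) (L - 1 / 4 * L)},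
                  ENNReal.ofReal ‖Φ.ψ (Matrix.vecCons y (Matrix.vecTail W))‖) ^ 2) →
      ENNReal.ofReal ((c / 16 - η) * ((Real.exp (-2 * M) * ((1 - ε) ^ 3 * (c / 16))) *
          ((1 - ε) / (1 + 16 * Real.exp (2 * M) / (c * (1 - ε))))) / 2 *
          (n + 1 : ℕ)) ≤
        occupation (n + 1)
          (Set.indicator {x : Space | ∀ t, x t ∈ Set.Ioo (1 / 4 * L) (L - 1 / 4 * L)}
            (fun _ => ((Real.sqrt (((1 - 2 * (1 / 4)) * L) ^ 3))⁻¹ : ℂ)))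
          fun Z => (groundState v (n + 1) L Z : ℂ) := by
  sorry

/-- **Stub C** (LANDED p140758, `CoupledBaths.stub_closing`). -/
theorem stub_closing :
    ∀ v : ℝ → ℝ≥0∞, IsRepulsiveFiniteRange v → BECWallDressingTransfer.GroundStateRigidity →
    ∃ ρ₂ : ℝ, 0 < ρ₂ ∧ ∀ ρ : ℝ, 0 < ρ → ρ < ρ₂ → ∀ κ : ℝ, 0 < κ →
      (∀ᶠ n : ℕ in atTop,
        groundStateEnergy v (n + 1) (sideLength ρ (n + 1)) ≠ ⊤ ∧
        ENNReal.ofReal (κ * (n + 1 : ℕ)) ≤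
          occupation (n + 1)
            (Set.indicator {x : Space | ∀ t, x t ∈ Set.Ioo (1 / 4 * sideLength ρ (n + 1)) (sideLength ρ (n + 1) - 1 / 4 * sideLength ρ (n + 1))}
              (fun _ => ((Real.sqrt (((1 - 2 * (1 / 4)) * sideLength ρ (n + 1)) ^ 3))⁻¹ : ℂ)))
            fun Z => (groundState v (n + 1) (sideLength ρ (n + 1)) Z : ℂ)) →
      HasGroundStateBEC v ρ :=
  _root_.Summit.AtomisticToContinuum.BoseEinsteinCondensation.CoupledBaths.stub_closing

/-- **Stub Rig** (POOLED item stmt-AtomisticToContinuum-9072, verbatim the imported route decl):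
`L²`-rigidity of Dirichlet near-minimisers up to phase. -/
theorem stub_rigidity : BECWallDressingTransfer.GroundStateRigidity := by
  sorry

/-! ### The unfolded stub signatures are definitionally the named statements -/

example : TorusTypicality := stub_torusTypicalityBath
example : CoupledRelocationBound := stub_coupledRelocationBoundL1
example : MultiplicativeFlatnessTransfer := stub_multiplicativeTransfer
example : BoxTransfer := stub_boxTransferL1
example : ClosingChain := stub_closing

/-! ### Assembly (proved) -/

/-- The box constant (v3) is positive for ANY tolerance `ε < 1` and `η < c/16` — the point of the
v3 reshape: `ε` is no longer tied to `c`. -/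
theorem boxConstant_pos {c ε η : ℝ} (M : ℝ) (hc : 0 < c) (hε1 : ε < 1) (hη : η < c / 16) :
    0 < boxConstant c ε η M := by
  unfold boxConstant
  have h1 : 0 < c / 16 - η := by linarith
  have h2 : 0 < 1 - ε := by linarith
  positivity

/-- **Assembly** (quantifier bookkeeping; proved; v3).  Given `v` admissible and the `A`-instance
`PeriodicBECAt v` (constant `c` below `ρ_A`), take `ρ₀ := min (min ρ_A ρ₁) (min ρ_e ρ₂)` with `ρ₁`
from R‴, `ρ_e` from the eventual finiteness of `E₀^D`
(`BECInsertionVariance.eventually_groundStateEnergy_ne_top`) and `ρ₂` from C; fix `η := c/32` and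
get the tolerance `ε ∈ (0,1)` and the cost bound `M` from R‴ (v3: `ε` is R‴'s to choose); eventually
in `n` (shifting `A` and the finiteness to `N = n+1` along `tendsto_add_atTop_nat 1`): T′ at slack
`min δ_A δ_R` gives the torus near-minimiser `Φ` and its typical bath event, R‴ the coupling, B‴ the
inner flat-mode occupation `≥ κ(c,ε,η,M)(n+1)` of the Dirichlet ground state, and C closes
`HasGroundStateBEC v ρ`. -/
theorem assembly (hT : TorusTypicality) (hR : CoupledRelocationBound)
    (hM : MultiplicativeFlatnessTransfer) (hB : BoxTransfer) (hC : ClosingChain)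
    (hRig : BECWallDressingTransfer.GroundStateRigidity) :
    BECInsertionCorrector.BoundaryTransferWeak := by
  intro v hv hA
  obtain ⟨ρA, hρA, HA⟩ := hA
  obtain ⟨ρ₁, hρ₁, HR⟩ := hR v hv
  obtain ⟨ρe, hρe, HE⟩ :=
    Summit.AtomisticToContinuum.BoseEinsteinCondensation.Theorems.BECInsertionVariance.eventually_groundStateEnergy_ne_top
      hv
  obtain ⟨ρ₂, hρ₂, HC⟩ := hC v hv hRig
  refine ⟨min (min ρA ρ₁) (min ρe ρ₂), lt_min (lt_min hρA hρ₁) (lt_min hρe hρ₂),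
    fun ρ hρ hρlt => ?_⟩
  have hρA' : ρ < ρA := hρlt.trans_le ((min_le_left _ _).trans (min_le_left _ _))
  have hρ₁' : ρ < ρ₁ := hρlt.trans_le ((min_le_left _ _).trans (min_le_right _ _))
  have hρe' : ρ < ρe := hρlt.trans_le ((min_le_right _ _).trans (min_le_left _ _))
  have hρ₂' : ρ < ρ₂ := hρlt.trans_le ((min_le_right _ _).trans (min_le_right _ _))
  obtain ⟨c, hc, hAev⟩ := HA ρ hρ hρA'
  -- the failure tolerance `η`, fixed before `N`; the exceptional-set tolerance `ε ∈ (0,1)` and the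
  -- cost bound `M` are supplied by R‴ (v3)
  set η : ℝ := c / 32 with hηdef
  have hη : 0 < η := by positivity
  have hη' : η < c / 16 := by rw [hηdef]; linarith
  obtain ⟨ε, M, hε, hε1, hRev⟩ := HR ρ hρ hρ₁' η hη
  have hκ : 0 < boxConstant c ε η M := boxConstant_pos M hc hε1 hη'
  -- shift `A` and the finiteness of `E₀^D` to `N = n + 1`
  have hAev' := (tendsto_add_atTop_nat 1).eventually hAev
  have hEev' := (tendsto_add_atTop_nat 1).eventually (HE ρ hρ hρe')
  refine HC ρ hρ hρ₂' (boxConstant c ε η M) hκ ?_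
  filter_upwards [hAev', hEev', hRev] with n hAn hEn hRn
  refine ⟨hEn, ?_⟩
  obtain ⟨δA, hδA, hAΦ⟩ := hAn
  obtain ⟨δR, hδR, hRΦ⟩ := hRn hEn
  have hL : 0 < sideLength ρ (n + 1) := by
    unfold sideLength
    exact Real.rpow_pos_of_pos (div_pos (Nat.cast_pos.mpr (Nat.succ_pos n)) hρ) _
  -- T′ at slack `min δA δR`: the torus near-minimiser and its typical bath event
  obtain ⟨Φ, hΦE, E, hEm, hPE, hEgood⟩ := hT v n (sideLength ρ (n + 1)) hL c hc (min δA δR)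
    (lt_min hδA hδR) fun Φ hΦ => hAΦ Φ (hΦ.trans (add_le_add_right (min_le_left _ _) _))
  -- R‴: the coupling with its good event
  obtain ⟨π, hπ1, hπ2, G, hG, hπG, hGood⟩ :=
    hRΦ Φ (hΦE.trans (add_le_add_right (min_le_right _ _) _))
  -- B‴: the inner flat mode of the box is occupied in the Dirichlet ground state
  exact hB hM v n (sideLength ρ (n + 1)) hL hEn c ε η M hc hε hε1 hη hη' Φ
    ⟨π, hπ1, hπ2, G, hG, hπG, hGood⟩ ⟨E, hEm, hPE, hEgood⟩

/-! ### Composition -/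

/-- **The crux from the registered stubs (by name).** -/
theorem BoundaryTransferWeak_of : BECInsertionCorrector.BoundaryTransferWeak :=
  assembly stub_torusTypicalityBath stub_coupledRelocationBoundL1 stub_multiplicativeTransfer
    stub_boxTransferL1 stub_closing stub_rigidity

/-- **The crux as recorded on the item** (`BECPeriodicReduction.BoundaryTransferWeak`, the decl the
ledger item stmt-AtomisticToContinuum-0827 carries; shared verbatim — `rfl` — with
`BECInsertionCorrector.BoundaryTransferWeak` and 75 other route files). -/
theorem BoundaryTransferWeak_proof : BECPeriodicReduction.BoundaryTransferWeak :=
  BoundaryTransferWeak_of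

/-- Sanity: the two route copies are syntactically the same `Prop`. -/
example : BECInsertionCorrector.BoundaryTransferWeak = BECPeriodicReduction.BoundaryTransferWeak :=
  rfl

end Summit.AtomisticToContinuum.BoseEinsteinCondensation.Cruxes.BoundaryTransferWeak.CoupledBaths

end
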